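import Literature.Probability.Process.LevyCharacterisation
import Literature.Probability.Process.BrownianVec
import Mathlib.Probability.Independence.CharacteristicFunction
import Mathlib.Analysis.InnerProductSpace.PiL2
import Mathlib.Analysis.Normed.Lp.MeasurableSpace
import HarnessLib

/-!
# Lévy's characterisation of `n`-dimensional Brownian motion, I: increments

Topic `Probability/Process`; theorems only (no definition, no named fact).  The tree's Lévy
characterisation (`LevyCharacterisation.lean`, discharging `Process.levy_characterisation`) is
one-dimensional.  This file and its sequel `LevyCharacterisationVecMarkov.lean` prove the **vector
version** (Le Gall (2016), Thm 5.12 for `d ≥ 1`; Revuz–Yor (1999), Ch. IV, Thm (3.6)): let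
`M : ℝ≥0 → Ω → (Fin n → ℝ)` be a process on a probability space with a raw filtration `𝓕` of `ℝ≥0`,
a.s. continuous paths and `M 0 = 0` a.s., such that for every unit vector `θ ∈ ℝⁿ` the real process
`θ · M` and `(θ · M)² - t` are local martingales — `⟨Mⁱ, Mʲ⟩_t = δ_{ij} t` tested along lines (for
genuine martingales `Mⁱ` with `Mⁱ Mʲ - δ_{ij} t` martingales this holds, see part II).  Then

* `integral_mul_cexp_dot_sub_eq` — the conditional characteristic function of the increments:
  `E[G e^{iθ·(M_t - M_s)}] = e^{-|θ|²(t-s)/2} E[G]` for `s ≤ t`, every `θ ∈ ℝⁿ` and every bounded complex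
  `𝓕 s`-a.e.-measurable weight `G` (the one-dimensional `integral_mul_cexp_sub_eq_of_isLocalMartingale`
  applied to the unit vector `θ/|θ|` with frequency `|θ|`);
* `hasLaw_sub_gaussVec` — `M_t - M_s ∼ N(0, (t-s) I_n)` (`gaussVec n (t - s)`; characteristic functions
  read on the Euclidean space `PiLp 2`, `charFun_map_toLp_gaussVec`, Mathlib `Measure.ext_of_charFun`), in
  particular `M_t ∼ gaussVec n t` (`hasLaw_gaussVec`);
* `exists_const_integral_mul_cexp_shift_sum` — for finitely many shifts `u ∈ J` and frequencies `η_u`,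
  `E[G exp(i Σ_{u∈J} η_u·(M_{s+u} - M_s))] = c · E[G]` with a constant `c` depending on `J, η` only —
  NOT on the base time `s` or the weight `G` (induction on the largest shift).  Part II turns this into
  the independence of the shifted process from `𝓕 s`, its path law, and `IsBrownianVec M P`.

No usual conditions on `𝓕`.

## References

* J.-F. Le Gall, *Brownian Motion, Martingales, and Stochastic Calculus*, GTM 274 (2016), Thm 5.12
  (Lévy's theorem, `d`-dimensional statement and proof via `exp(iξ·M_t + |ξ|²t/2)`).
* D. Revuz, M. Yor, *Continuous Martingales and Brownian Motion* (3rd ed., 1999), Ch. IV, Thm (3.6).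
-/

set_option autoImplicit false

noncomputable section

open MeasureTheory ProbabilityTheory Filter Topology Complex Finset
open scoped NNReal ENNReal BigOperators

namespace Literature.Probability.Process

variable {Ω : Type*} {m : MeasurableSpace Ω} {P : Measure Ω} {n : ℕ}
  {M : ℝ≥0 → Ω → (Fin n → ℝ)} {𝓕 : Filtration ℝ≥0 m}

/-! ### Preliminaries: sums a.e. measurable for a sub-σ-algebra; coordinates -/

/-- Finite sums of functions a.e. strongly measurable with respect to a sub-σ-algebra are a.e. strongly
measurable with respect to it (complex-valued, any index type). [folklore] -/
private theorem aestronglyMeasurable_finset_sum_sub {ι : Type*} {m' : MeasurableSpace Ω} {μ : Measure[m] Ω}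
    {f : ι → Ω → ℂ} (s : Finset ι) (hf : ∀ k ∈ s, AEStronglyMeasurable[m'] (f k) μ) :
    AEStronglyMeasurable[m'] (fun ω ↦ ∑ k ∈ s, f k ω) μ := by
  classical
  induction s using Finset.induction_on with
  | empty => simpa using (stronglyMeasurable_const (b := (0 : ℂ))).aestronglyMeasurable
  | insert a s ha ih =>
    simp_rw [Finset.sum_insert ha]
    exact (hf a (Finset.mem_insert_self a s)).add
      (ih fun k hk ↦ hf k (Finset.mem_insert_of_mem hk))

/-- Real version of `aestronglyMeasurable_finset_sum_sub`. [folklore] -/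
private theorem aestronglyMeasurable_finset_sum_sub_real {ι : Type*} {m' : MeasurableSpace Ω} {μ : Measure[m] Ω}
    {f : ι → Ω → ℝ} (s : Finset ι) (hf : ∀ k ∈ s, AEStronglyMeasurable[m'] (f k) μ) :
    AEStronglyMeasurable[m'] (fun ω ↦ ∑ k ∈ s, f k ω) μ := by
  classical
  induction s using Finset.induction_on with
  | empty => simpa using (stronglyMeasurable_const (b := (0 : ℝ))).aestronglyMeasurable
  | insert a s ha ih =>
    simp_rw [Finset.sum_insert ha]
    exact (hf a (Finset.mem_insert_self a s)).add
      (ih fun k hk ↦ hf k (Finset.mem_insert_of_mem hk))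

/-- The sum of squares of the coordinates of the `i`-th standard basis vector is `1`. [folklore] -/
private theorem sum_sq_ite_eq_one (i : Fin n) :
    ∑ j, (if j = i then (1 : ℝ) else 0) ^ 2 = 1 := by
  simp [Finset.sum_ite_eq']

/-- Pairing with the `i`-th standard basis vector picks the `i`-th coordinate. [folklore] -/
private theorem sum_ite_mul_eq_apply (i : Fin n) (v : Fin n → ℝ) :
    ∑ j, (if j = i then (1 : ℝ) else 0) * v j = v i := by
  simp [Finset.sum_ite_eq', ite_mul]

/-! ### The characteristic function of `N(0, h I_n)` on the Euclidean space -/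

/-- **Characteristic function of `gaussVec n h = N(0, h I_n)`**, read on the Euclidean space `PiLp 2`:
`∫ e^{i⟨x, ξ⟩} dN(0, hI_n)(x) = exp(-h Σᵢ ξᵢ² / 2)` (product of the one-dimensional Gaussian characteristic
functions, Mathlib `charFun_gaussianReal`). [cite: Legall2016, Ch. 1 (Gaussian vectors)] -/
theorem charFun_map_toLp_gaussVec (h : ℝ≥0) (ξ : PiLp 2 fun _ : Fin n ↦ ℝ) :
    charFun ((gaussVec n h).map (WithLp.toLp 2)) ξ =
      cexp (-((h : ℝ) * (∑ i, (WithLp.ofLp ξ) i ^ 2) / 2 : ℝ)) := by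
  rw [charFun_apply, integral_map (WithLp.measurable_toLp 2 _).aemeasurable (by fun_prop)]
  have hinner : ∀ v : Fin n → ℝ, (inner ℝ (WithLp.toLp 2 v) ξ : ℝ) = ∑ i, (WithLp.ofLp ξ) i * v i := by
    intro v
    rw [PiLp.inner_apply]
    refine Finset.sum_congr rfl fun i _ ↦ ?_
    simp [mul_comm]
  simp_rw [hinner]
  have e1 : ∀ v : Fin n → ℝ, cexp ((∑ i, (WithLp.ofLp ξ) i * v i : ℝ) * I) =
      ∏ i, cexp (((WithLp.ofLp ξ) i : ℂ) * (v i : ℂ) * I) := by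
    intro v
    rw [← Complex.exp_sum]
    congr 1
    push_cast
    rw [Finset.sum_mul]
  simp_rw [e1]
  have hpi := integral_fintype_prod_eq_prod (𝕜 := ℂ)
    (f := fun i (x : ℝ) ↦ cexp (((WithLp.ofLp ξ) i : ℂ) * (x : ℂ) * I))
    (μ := fun _ : Fin n ↦ gaussianReal 0 h)
  rw [gaussVec, hpi]
  have e2 : ∀ i, ∫ x : ℝ, cexp (((WithLp.ofLp ξ) i : ℂ) * (x : ℂ) * I) ∂gaussianReal 0 h =
      cexp (-((h : ℝ) * (WithLp.ofLp ξ) i ^ 2 / 2 : ℝ)) := by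
    intro i
    rw [← charFun_apply_real, charFun_gaussianReal]
    congr 1
    push_cast
    ring
  simp_rw [e2]
  rw [← Complex.exp_sum]
  congr 1
  push_cast
  rw [Finset.mul_sum, Finset.sum_div, ← Finset.sum_neg_distrib]

section LineHypotheses

variable
  (hM : ∀ θ : Fin n → ℝ, ∑ i, θ i ^ 2 = 1 →
    RandomPlanarGeometry.IsLocalMartingale (fun t ω ↦ ∑ i, θ i * M t ω i) 𝓕 P ∧
    RandomPlanarGeometry.IsLocalMartingale (fun t ω ↦ (∑ i, θ i * M t ω i) ^ 2 - (t : ℝ)) 𝓕 P)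
include hM

/-- Each coordinate `Mⁱ` is a local martingale (the hypothesis at the `i`-th basis vector). [folklore] -/
private theorem isLocalMartingale_apply_of_forall_dot (i : Fin n) :
    RandomPlanarGeometry.IsLocalMartingale (fun t ω ↦ M t ω i) 𝓕 P := by
  have h := (hM (fun j ↦ if j = i then 1 else 0) (sum_sq_ite_eq_one i)).1
  simp_rw [sum_ite_mul_eq_apply] at h
  exact h

/-- Each coordinate `M_t ⁱ` is `𝓕 t`-a.e.-strongly measurable. [folklore] -/
private theorem aestronglyMeasurable_apply_of_forall_dot (t : ℝ≥0) (i : Fin n) :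
    AEStronglyMeasurable[𝓕 t] (fun ω ↦ M t ω i) P :=
  (isLocalMartingale_apply_of_forall_dot hM i).aestronglyMeasurable t

/-- `M_t` is a.e. measurable. [folklore] -/
private theorem aemeasurable_of_forall_dot (t : ℝ≥0) : AEMeasurable (M t) P :=
  aemeasurable_pi_lambda _ fun i ↦
    (((aestronglyMeasurable_apply_of_forall_dot hM t i).mono (𝓕.le t)).aemeasurable)

/-- A real linear functional `Σᵢ cᵢ (M_r ⁱ - M_r' ⁱ)` of two values at times `r, r' ≤ t` is
`𝓕 t`-a.e.-strongly measurable. [folklore] -/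
private theorem aestronglyMeasurable_dot_sub_of_forall_dot {r r' t : ℝ≥0} (hr : r ≤ t) (hr' : r' ≤ t)
    (c : Fin n → ℝ) :
    AEStronglyMeasurable[𝓕 t] (fun ω ↦ ∑ i, c i * (M r ω i - M r' ω i)) P :=
  aestronglyMeasurable_finset_sum_sub_real _ fun i _ ↦
    ((((aestronglyMeasurable_apply_of_forall_dot hM r i).mono (𝓕.mono hr)).sub
      ((aestronglyMeasurable_apply_of_forall_dot hM r' i).mono (𝓕.mono hr'))).const_mul _)

/-! ### The conditional characteristic function of the increments -/

variable [IsProbabilityMeasure P]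

/-- **Conditional characteristic function of the increments of `M` (vector form).** For `s ≤ t`,
`θ ∈ ℝⁿ` and a complex `𝓕 s`-a.e.-measurable weight `G` with `‖G‖ ≤ 1` a.e.:
`E[G e^{iθ·(M_t - M_s)}] = e^{-|θ|²(t-s)/2} E[G]`.  (For `θ ≠ 0` this is the one-dimensional
statement for the local martingale `θ̂·M`, `θ̂ = θ/|θ|`, at frequency `|θ|`.)
[cite: Legall2016, Thm 5.12 (proof)] -/
theorem integral_mul_cexp_dot_sub_eq (h0 : ∀ᵐ ω ∂P, M 0 ω = 0) (hc : ∀ᵐ ω ∂P, Continuous (M · ω))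
    {s t : ℝ≥0} (hst : s ≤ t) (θ : Fin n → ℝ) {G : Ω → ℂ} (hG : AEStronglyMeasurable[𝓕 s] G P)
    (hG1 : ∀ᵐ ω ∂P, ‖G ω‖ ≤ 1) :
    ∫ ω, G ω * cexp (I * (∑ i, θ i * (M t ω i - M s ω i) : ℝ)) ∂P =
      cexp (-((∑ i, θ i ^ 2) * ((t : ℝ) - s) / 2 : ℝ)) * ∫ ω, G ω ∂P := by
  by_cases hθ : ∑ i, θ i ^ 2 = 0
  · -- `θ = 0`
    have hθi : ∀ i, θ i = 0 := fun i ↦ by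
      have h := (Finset.sum_eq_zero_iff_of_nonneg (fun j _ ↦ sq_nonneg (θ j))).1 hθ i (Finset.mem_univ i)
      exact pow_eq_zero_iff (n := 2) (by norm_num) |>.1 h
    simp [hθi]
  · -- `θ ≠ 0`: normalise
    have hpos : 0 < ∑ i, θ i ^ 2 := lt_of_le_of_ne (Finset.sum_nonneg fun j _ ↦ sq_nonneg (θ j)) (Ne.symm hθ)
    set r : ℝ := Real.sqrt (∑ i, θ i ^ 2) with hr
    have hr0 : 0 < r := Real.sqrt_pos.2 hpos
    have hr2 : r ^ 2 = ∑ i, θ i ^ 2 := Real.sq_sqrt hpos.le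
    set θ' : Fin n → ℝ := fun i ↦ θ i / r with hθ'
    have hθ'1 : ∑ i, θ' i ^ 2 = 1 := by
      simp_rw [hθ', div_pow, ← Finset.sum_div, ← hr2]
      exact div_self (pow_ne_zero 2 hr0.ne')
    obtain ⟨hX, hq⟩ := hM θ' hθ'1
    have h0X : ∀ᵐ ω ∂P, (∑ i, θ' i * M 0 ω i) = 0 := by
      filter_upwards [h0] with ω hω
      simp [hω]
    have hcX : ∀ᵐ ω ∂P, Continuous fun t ↦ ∑ i, θ' i * M t ω i := by
      filter_upwards [hc] with ω hω
      exact continuous_finsetSum _ fun i _ ↦ ((continuous_apply i).comp hω).const_mul _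
    have key := integral_mul_cexp_sub_eq_of_isLocalMartingale hX hq h0X hcX hst r hG hG1
    have hlin : ∀ ω, r * ((∑ i, θ' i * M t ω i) - ∑ i, θ' i * M s ω i) =
        ∑ i, θ i * (M t ω i - M s ω i) := by
      intro ω
      rw [← Finset.sum_sub_distrib, Finset.mul_sum]
      refine Finset.sum_congr rfl fun i _ ↦ ?_
      have : r * θ' i = θ i := by rw [hθ']; field_simp
      rw [← mul_sub, ← mul_assoc, this]
    simp_rw [hlin] at key
    rw [key, hr2]

/-- **Characteristic function of an increment**: `E[e^{iθ·(M_t - M_s)}] = e^{-|θ|²(t-s)/2}` for `s ≤ t`.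
[cite: Legall2016, Thm 5.12 (proof)] -/
theorem integral_cexp_dot_sub_eq (h0 : ∀ᵐ ω ∂P, M 0 ω = 0) (hc : ∀ᵐ ω ∂P, Continuous (M · ω))
    {s t : ℝ≥0} (hst : s ≤ t) (θ : Fin n → ℝ) :
    ∫ ω, cexp (I * (∑ i, θ i * (M t ω i - M s ω i) : ℝ)) ∂P =
      cexp (-((∑ i, θ i ^ 2) * ((t : ℝ) - s) / 2 : ℝ)) := by
  have key := integral_mul_cexp_dot_sub_eq hM h0 hc hst θ (G := fun _ ↦ (1 : ℂ))
    stronglyMeasurable_const.aestronglyMeasurable (ae_of_all _ fun ω ↦ by simp)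
  simpa using key

/-! ### Gaussian increments -/

/-- **The increments are centred Gaussian vectors**: for `s ≤ t`, `M_t - M_s ∼ N(0, (t-s) I_n)`, i.e.
`HasLaw (M_t - M_s) (gaussVec n (t - s))` (characteristic functions on `ℝⁿ`, transported to the Euclidean
space `PiLp 2` where Mathlib's `Measure.ext_of_charFun` applies; `charFun_map_toLp_gaussVec`).
[cite: Legall2016, Thm 5.12 (proof)] -/
theorem hasLaw_sub_gaussVec (h0 : ∀ᵐ ω ∂P, M 0 ω = 0) (hc : ∀ᵐ ω ∂P, Continuous (M · ω))
    {s t : ℝ≥0} (hst : s ≤ t) :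
    HasLaw (fun ω ↦ M t ω - M s ω) (gaussVec n (t - s)) P := by
  have hΔ : AEMeasurable (fun ω ↦ M t ω - M s ω) P :=
    (aemeasurable_of_forall_dot hM t).sub (aemeasurable_of_forall_dot hM s)
  refine ⟨hΔ, ?_⟩
  haveI : IsProbabilityMeasure (gaussVec n (t - s)) := by
    unfold gaussVec; infer_instance
  -- transport to the Euclidean space `PiLp 2`
  have hinj : Function.Injective fun μ : Measure (Fin n → ℝ) ↦ μ.map (WithLp.toLp 2) := by
    intro μ ν hμν
    have h := congrArg (fun ρ : Measure (PiLp 2 fun _ : Fin n ↦ ℝ) ↦ ρ.map (WithLp.ofLp)) hμν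
    simp only at h
    rwa [Measure.map_map (WithLp.measurable_ofLp 2 _) (WithLp.measurable_toLp 2 _),
      Measure.map_map (WithLp.measurable_ofLp 2 _) (WithLp.measurable_toLp 2 _),
      show (WithLp.ofLp ∘ WithLp.toLp 2 : (Fin n → ℝ) → (Fin n → ℝ)) = id from funext fun _ ↦ rfl,
      Measure.map_id, Measure.map_id] at h
  refine hinj (Measure.ext_of_charFun (funext fun ξ ↦ ?_))
  dsimp only
  rw [charFun_map_toLp_gaussVec, AEMeasurable.map_map_of_aemeasurable (WithLp.measurable_toLp 2 _).aemeasurable hΔ,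
    charFun_apply, integral_map ((WithLp.measurable_toLp 2 _).comp_aemeasurable hΔ) (by fun_prop)]
  have hinner : ∀ v : Fin n → ℝ, (inner ℝ (WithLp.toLp 2 v) ξ : ℝ) = ∑ i, (WithLp.ofLp ξ) i * v i := by
    intro v
    rw [PiLp.inner_apply]
    refine Finset.sum_congr rfl fun i _ ↦ ?_
    simp [mul_comm]
  simp_rw [Function.comp_apply, hinner]
  have e1 : ∀ ω, cexp ((∑ i, (WithLp.ofLp ξ) i * (M t ω - M s ω) i : ℝ) * I) =
      cexp (I * (∑ i, (WithLp.ofLp ξ) i * (M t ω i - M s ω i) : ℝ)) := fun ω ↦ by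
    rw [mul_comm]; rfl
  simp_rw [e1, integral_cexp_dot_sub_eq hM h0 hc hst, NNReal.coe_sub hst]
  congr 1
  push_cast
  ring

/-- **Gaussian marginals**: `M_t ∼ N(0, t I_n) = gaussVec n t`. [cite: Legall2016, Thm 5.12 (proof)] -/
theorem hasLaw_gaussVec (h0 : ∀ᵐ ω ∂P, M 0 ω = 0) (hc : ∀ᵐ ω ∂P, Continuous (M · ω)) (t : ℝ≥0) :
    HasLaw (M t) (gaussVec n t) P := by
  have h := hasLaw_sub_gaussVec hM h0 hc (show (0 : ℝ≥0) ≤ t from bot_le)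
  rw [tsub_zero] at h
  refine ⟨aemeasurable_of_forall_dot hM t, ?_⟩
  rw [← h.map_eq]
  refine Measure.map_congr ?_
  filter_upwards [h0] with ω hω
  simp [hω]

/-! ### Finitely many shifted values: a constant conditional characteristic function -/

/-- **Key lemma (induction on the largest shift).** For finitely many shifts `u ∈ J` and frequencies
`η_u ∈ ℝⁿ` there is a constant `c ∈ ℂ`, depending on `J` and `η` only, with
`E[G exp(i Σ_{u∈J} η_u·(M_{s+u} - M_s))] = c · E[G]` for EVERY base time `s` and every complex
`𝓕 s`-a.e.-measurable weight `G` with `‖G‖ ≤ 1` (peel off the largest shift `a` with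
`integral_mul_cexp_dot_sub_eq` between `s + b` and `s + a`, `b` the next largest shift, moving
`η_a·(M_{s+b} - M_s)` into the weight). [cite: Legall2016, Thm 5.12 (proof)] -/
theorem exists_const_integral_mul_cexp_shift_sum (h0 : ∀ᵐ ω ∂P, M 0 ω = 0)
    (hc : ∀ᵐ ω ∂P, Continuous (M · ω)) (J : Finset ℝ≥0) (η : ℝ≥0 → Fin n → ℝ) :
    ∃ c : ℂ, ∀ (s : ℝ≥0) (G : Ω → ℂ), AEStronglyMeasurable[𝓕 s] G P → (∀ᵐ ω ∂P, ‖G ω‖ ≤ 1) →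
      ∫ ω, G ω * cexp (I * (∑ u ∈ J, ∑ i, η u i * (M (s + u) ω i - M s ω i) : ℝ)) ∂P =
        c * ∫ ω, G ω ∂P := by
  classical
  induction J using Finset.induction_on_max generalizing η with
  | empty => exact ⟨1, fun s G _ _ ↦ by simp⟩
  | insert a J haJ ih =>
    -- `b`: the largest shift of `J` (or `0` if `J = ∅`)
    set b : ℝ≥0 := if hJ : J.Nonempty then J.max' hJ else 0 with hb_def
    have hba : b ≤ a := by
      by_cases hJ : J.Nonempty
      · rw [hb_def, dif_pos hJ]; exact (haJ _ (J.max'_mem hJ)).le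
      · rw [hb_def, dif_neg hJ]; exact bot_le
    have hJb : ∀ u ∈ J, u ≤ b := fun u hu ↦ by
      have hJ : J.Nonempty := ⟨u, hu⟩
      rw [hb_def, dif_pos hJ]; exact J.le_max' u hu
    -- move `η_a·(M_{s+b} - M_s)` into the frequencies of `J`
    set η' : ℝ≥0 → Fin n → ℝ := fun u ↦ if u = b then η u + η a else η u with hη'
    obtain ⟨c', hc'⟩ := ih η'
    refine ⟨cexp (-((∑ i, η a i ^ 2) * ((a : ℝ) - b) / 2 : ℝ)) * c', fun s G hG hG1 ↦ ?_⟩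
    have hB : ∀ ω, (∑ u ∈ insert a J, ∑ i, η u i * (M (s + u) ω i - M s ω i)) =
        (∑ i, η a i * (M (s + a) ω i - M (s + b) ω i)) +
          ∑ u ∈ J, ∑ i, η' u i * (M (s + u) ω i - M s ω i) := by
      intro ω
      rw [Finset.sum_insert (fun h ↦ (lt_irrefl a) (haJ a h))]
      by_cases hJ : J.Nonempty
      · have hbJ : b ∈ J := by rw [hb_def, dif_pos hJ]; exact J.max'_mem hJ
        have hsplit : ∑ u ∈ J, ∑ i, η' u i * (M (s + u) ω i - M s ω i) =
            (∑ u ∈ J, ∑ i, η u i * (M (s + u) ω i - M s ω i)) +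
              ∑ i, η a i * (M (s + b) ω i - M s ω i) := by
          have h1 : ∀ u ∈ J, ∑ i, η' u i * (M (s + u) ω i - M s ω i) =
              (∑ i, η u i * (M (s + u) ω i - M s ω i)) +
                if u = b then ∑ i, η a i * (M (s + u) ω i - M s ω i) else 0 := by
            intro u _
            by_cases hub : u = b
            · simp only [hη', hub, if_true, Pi.add_apply, add_mul, Finset.sum_add_distrib]
            · simp only [hη', hub, if_false, add_zero]
          rw [Finset.sum_congr rfl h1, Finset.sum_add_distrib, Finset.sum_ite_eq' J b, if_pos hbJ]
        rw [hsplit]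
        have h2 : ∑ i, η a i * (M (s + a) ω i - M s ω i) =
            (∑ i, η a i * (M (s + a) ω i - M (s + b) ω i)) + ∑ i, η a i * (M (s + b) ω i - M s ω i) := by
          rw [← Finset.sum_add_distrib]
          exact Finset.sum_congr rfl fun i _ ↦ by ring
        rw [h2]; ring
      · have hJe : J = ∅ := Finset.not_nonempty_iff_eq_empty.1 hJ
        have hb0 : b = 0 := by rw [hb_def, dif_neg hJ]
        simp [hJe, hb0]
    -- the new weight
    set Gt : Ω → ℂ := fun ω ↦
      G ω * cexp (I * (∑ u ∈ J, ∑ i, η' u i * (M (s + u) ω i - M s ω i) : ℝ)) with hGt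
    have hGtm : AEStronglyMeasurable[𝓕 (s + b)] Gt P := by
      refine (hG.mono (𝓕.mono (self_le_add_right s b))).mul ?_
      refine (by fun_prop : Continuous fun x : ℝ ↦ cexp (I * x)).comp_aestronglyMeasurable ?_
      exact aestronglyMeasurable_finset_sum_sub_real J fun u hu ↦
        aestronglyMeasurable_dot_sub_of_forall_dot hM ((add_le_add_iff_left s).2 (hJb u hu))
          (self_le_add_right s b) (η' u)
    have hGt1 : ∀ᵐ ω ∂P, ‖Gt ω‖ ≤ 1 := by
      filter_upwards [hG1] with ω hω
      rw [hGt, norm_mul, Complex.norm_exp_I_mul_ofReal, mul_one]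
      exact hω
    have key := integral_mul_cexp_dot_sub_eq hM h0 hc ((add_le_add_iff_left s).2 hba) (η a) hGtm hGt1
    have hih := hc' s G hG hG1
    have hprod : ∀ ω, G ω * cexp (I * (∑ u ∈ insert a J, ∑ i, η u i * (M (s + u) ω i - M s ω i) : ℝ)) =
        Gt ω * cexp (I * (∑ i, η a i * (M (s + a) ω i - M (s + b) ω i) : ℝ)) := by
      intro ω
      rw [hB ω, hGt, mul_assoc, ← Complex.exp_add]
      congr 2
      push_cast
      ring
    simp_rw [hprod]
    rw [key]
    have hexp : cexp (-((∑ i, η a i ^ 2) * (((s + a : ℝ≥0) : ℝ) - ((s + b : ℝ≥0) : ℝ)) / 2 : ℝ)) =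
        cexp (-((∑ i, η a i ^ 2) * ((a : ℝ) - b) / 2 : ℝ)) := by
      congr 1
      push_cast
      ring
    rw [hexp, hGt, hih, mul_assoc]

/-- Characteristic function of finitely many shifted values, weight `G = 1`:
`E[exp(i Σ_{u∈J} η_u·(M_{s+u} - M_s))]` is the constant of
`exists_const_integral_mul_cexp_shift_sum`, the same for every base time `s`. [cite: Legall2016, Thm 5.12 (proof)] -/
theorem integral_cexp_shift_sum_eq_integral_cexp_shift_sum (h0 : ∀ᵐ ω ∂P, M 0 ω = 0)
    (hc : ∀ᵐ ω ∂P, Continuous (M · ω)) (J : Finset ℝ≥0) (η : ℝ≥0 → Fin n → ℝ) (s s' : ℝ≥0) :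
    ∫ ω, cexp (I * (∑ u ∈ J, ∑ i, η u i * (M (s + u) ω i - M s ω i) : ℝ)) ∂P =
      ∫ ω, cexp (I * (∑ u ∈ J, ∑ i, η u i * (M (s' + u) ω i - M s' ω i) : ℝ)) ∂P := by
  obtain ⟨c, hcc⟩ := exists_const_integral_mul_cexp_shift_sum hM h0 hc J η
  have h1 := hcc s (fun _ ↦ 1) stronglyMeasurable_const.aestronglyMeasurable (ae_of_all _ fun ω ↦ by simp)
  have h2 := hcc s' (fun _ ↦ 1) stronglyMeasurable_const.aestronglyMeasurable (ae_of_all _ fun ω ↦ by simp)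
  simp only [one_mul] at h1 h2
  rw [h1, h2]

end LineHypotheses

end Literature.Probability.Process

end
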